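import Mathlib.Algebra.MvPolynomial.Division
import Mathlib.RingTheory.Ideal.Quotient.Operations
import Summits.ResolutionOfSingularities.ResolutionOfSingularities.Theorems.EquisingularLiftEquisingularLiftNatMultipleTraces
import HarnessLib

/-!
# T-USELESS, second computation: complete-intersection-with-`H` centres have CARTIER trace on `H`

[OURS · L1 W4.5(b)] Third part of the T-USELESS/T-USEFUL object (p503986 `…SheetTangent`, p504649 `…SheetTangentModel`)
for the research stub `stub_elnat_three_nonisolated` of the crux `EquisingularLiftNat` (stmt-ResolutionOfSingularities-20038;
res-L1-w45b-lead-2 LEAD-MEMO-1 sha16 438b5e61c3cbba83 §3 bullet 5 «CI-with-`H` centres (`C_k = H ∩ G`, even sheet-tangent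
`G`) are useless: `𝓘·𝒪_H = (Ḡ)` invertible»; res-L1-w45b-stub-4 06:02:20Z reads it as the first half of the pair). NOT a
statement of any manuscript; AI-written kernel lemmas of the cell `res-hironaka` (weaker than expert review). Typed by
res-type-004.

**The computation.** If the special fibre of the centre is a complete intersection WITH `H`, i.e. `I_Z = I_H + (g)` for a
surface germ `G = {g = 0}`, then its trace on `𝒪_H = R / I_H` is the principal ideal `(ḡ)` (`map_sup_span_singleton`,
`map_span_pair`), and `ḡ` is a non-zero-divisor as soon as `G` contains no sheet of `H`: for `I_H = P ⊓ Q` with `P`, `Q`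
prime (the two sheets at a normal-crossings point of the double curve) and `g ∉ P ∪ Q`, `ḡ ∈ nonZeroDivisors (R ⧸ I_H)`
(`mk_mem_nonZeroDivisors_of_inf_eq`; any finite intersection of primes: `mk_mem_nonZeroDivisors_of_iInf_eq`). A principal
ideal generated by a non-zero-divisor is invertible, so the blow-up of `H` along `Z` is an isomorphism: USELESS, whether or
not `G` is tangent to a sheet. Model instance (`model_ci_trace`): `R = A[σ,τ,w]` (`MvPolynomial (Fin 3) A`, `A` a domain),
`I_H = (σ) ⊓ (τ) = (στ)` (res-L1-w45b-stub-4's `Junction.span_X0_inf_span_X1`, p503414), `g` divisible by neither `σ` nor `τ`.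

No definitions. References: folklore commutative algebra; the lead's hand computation LEAD-MEMO-1 §3 bullet 5 (cell-internal).
-/

-- single-problem summit: the doubled namespace component `ResolutionOfSingularities` is forced
set_option linter.dupNamespace false

namespace Summit.ResolutionOfSingularities.ResolutionOfSingularities.Cruxes.EquisingularLiftNat.Sections.SheetTangent

section AnyRing

variable {R : Type*} [CommRing R]

/-- **Trace of a CI-with-`H` centre.** For any ideal `I` (of `H`) and any `g`: the image of `I + (g)` in `R ⧸ I` is the
principal ideal `(ḡ)`. [folklore] -/
theorem map_sup_span_singleton (I : Ideal R) (g : R) :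
    (I ⊔ Ideal.span {g}).map (Ideal.Quotient.mk I) = Ideal.span {Ideal.Quotient.mk I g} := by
  rw [Ideal.map_sup, Ideal.map_quotient_self, bot_sup_eq, Ideal.map_span, Set.image_singleton]

/-- **Trace of a CI-with-`H` centre, two-generator form.** If `h ∈ I` (e.g. `h = στ` the equation of `H`) then the image
of `(h, g)` in `R ⧸ I` is `(ḡ)`. [folklore] -/
theorem map_span_pair (I : Ideal R) {h : R} (hh : h ∈ I) (g : R) :
    (Ideal.span {h, g}).map (Ideal.Quotient.mk I) = Ideal.span {Ideal.Quotient.mk I g} := by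
  rw [Ideal.map_span, Set.image_insert_eq, Set.image_singleton, Ideal.Quotient.eq_zero_iff_mem.2 hh,
    Ideal.span_insert_zero]

/-- **The generator is a non-zero-divisor when `G` contains no sheet (two sheets).** If `I = P ⊓ Q` with `P`, `Q` prime
and `g ∉ P`, `g ∉ Q`, then `ḡ` is a non-zero-divisor of `R ⧸ I`: `ȳ ḡ = 0` means `y g ∈ P` and `y g ∈ Q`, so `y ∈ P ⊓ Q`.
Reading: at a normal-crossings point of the double curve `I_H = (σ) ⊓ (τ)`, and a germ `G = {g = 0}` containing neither
sheet gives an invertible trace `(ḡ)` — the CI-with-`H` centre is USELESS (LEAD-MEMO-1 §3 bullet 5). [folklore] -/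
theorem mk_mem_nonZeroDivisors_of_inf_eq (I P Q : Ideal R) [P.IsPrime] [Q.IsPrime] (hI : P ⊓ Q = I) {g : R}
    (hP : g ∉ P) (hQ : g ∉ Q) : Ideal.Quotient.mk I g ∈ nonZeroDivisors (R ⧸ I) := by
  subst hI
  refine (mem_nonZeroDivisors_iff_right).2 fun y hy => ?_
  obtain ⟨y, rfl⟩ := Ideal.Quotient.mk_surjective y
  rw [← map_mul, Ideal.Quotient.eq_zero_iff_mem, Ideal.mem_inf] at hy
  exact Ideal.Quotient.eq_zero_iff_mem.2 (Ideal.mem_inf.2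
    ⟨(‹P.IsPrime›.mem_or_mem hy.1).resolve_right hP, (‹Q.IsPrime›.mem_or_mem hy.2).resolve_right hQ⟩)

/-- **The generator is a non-zero-divisor when `G` contains no sheet (any finite number of sheets / components).** If
`I = ⨅ i, P i` over a finite index type with every `P i` prime and `g ∉ P i` for all `i`, then `ḡ` is a non-zero-divisor
of `R ⧸ I` (ordinary `r`-fold points of the singular locus). [folklore] -/
theorem mk_mem_nonZeroDivisors_of_iInf_eq {ι : Type*} (I : Ideal R) (P : ι → Ideal R) (hprime : ∀ i, (P i).IsPrime)
    (hI : ⨅ i, P i = I) {g : R} (hg : ∀ i, g ∉ P i) : Ideal.Quotient.mk I g ∈ nonZeroDivisors (R ⧸ I) := by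
  subst hI
  refine (mem_nonZeroDivisors_iff_right).2 fun y hy => ?_
  obtain ⟨y, rfl⟩ := Ideal.Quotient.mk_surjective y
  rw [← map_mul, Ideal.Quotient.eq_zero_iff_mem, Ideal.mem_iInf] at hy
  exact Ideal.Quotient.eq_zero_iff_mem.2 (Ideal.mem_iInf.2 fun i => ((hprime i).mem_or_mem (hy i)).resolve_right (hg i))

/-- **CI-with-`H` centres are useless (packaged).** `I = P ⊓ Q` (`P`, `Q` prime), `g ∉ P ∪ Q`: the trace of `I + (g)` on
`R ⧸ I` is principal AND generated by a non-zero-divisor (an invertible ideal; its blow-up is an isomorphism). [folklore] -/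
theorem ciTrace_eq_span_and_mem_nonZeroDivisors (I P Q : Ideal R) [P.IsPrime] [Q.IsPrime] (hI : P ⊓ Q = I) {g : R}
    (hP : g ∉ P) (hQ : g ∉ Q) :
    (I ⊔ Ideal.span {g}).map (Ideal.Quotient.mk I) = Ideal.span {Ideal.Quotient.mk I g} ∧
      Ideal.Quotient.mk I g ∈ nonZeroDivisors (R ⧸ I) :=
  ⟨map_sup_span_singleton I g, mk_mem_nonZeroDivisors_of_inf_eq I P Q hI hP hQ⟩

end AnyRing

section Model

open MvPolynomial

/-- **Model instance** in `𝒪_H = A[σ,τ,w]/(στ)` (`MvPolynomial (Fin 3) A`, `A` a domain; `σ = X 0`, `τ = X 1`; the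
two sheets `(σ)`, `(τ)` are prime and `(σ) ⊓ (τ) = (στ)` by res-L1-w45b-stub-4's `Junction.span_X0_inf_span_X1`): for
every `g` divisible by neither `σ` nor `τ` (the germ `G = {g = 0}` contains no sheet — tangent to a sheet or not), the trace
of the CI-with-`H` centre `(στ, g)` on `𝒪_H` is `(ḡ)` with `ḡ` a non-zero-divisor. [folklore] -/
theorem model_ci_trace {A : Type*} [CommRing A] [IsDomain A] (g : MvPolynomial (Fin 3) A)
    (h0 : ¬ (X 0 : MvPolynomial (Fin 3) A) ∣ g) (h1 : ¬ (X 1 : MvPolynomial (Fin 3) A) ∣ g) :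
    (Ideal.span {(X 0 : MvPolynomial (Fin 3) A) * X 1, g}).map
        (Ideal.Quotient.mk (Ideal.span {(X 0 : MvPolynomial (Fin 3) A) * X 1})) =
      Ideal.span {Ideal.Quotient.mk (Ideal.span {(X 0 : MvPolynomial (Fin 3) A) * X 1}) g} ∧
    Ideal.Quotient.mk (Ideal.span {(X 0 : MvPolynomial (Fin 3) A) * X 1}) g ∈
      nonZeroDivisors (MvPolynomial (Fin 3) A ⧸ Ideal.span {(X 0 : MvPolynomial (Fin 3) A) * X 1}) := by
  have hX0 : Prime (X 0 : MvPolynomial (Fin 3) A) := MvPolynomial.X_prime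
  have hX1 : Prime (X 1 : MvPolynomial (Fin 3) A) := MvPolynomial.X_prime
  haveI hP : (Ideal.span {(X 0 : MvPolynomial (Fin 3) A)}).IsPrime :=
    (Ideal.span_singleton_prime hX0.ne_zero).2 hX0
  haveI hQ : (Ideal.span {(X 1 : MvPolynomial (Fin 3) A)}).IsPrime :=
    (Ideal.span_singleton_prime hX1.ne_zero).2 hX1
  refine ⟨map_span_pair _ (Ideal.mem_span_singleton_self _) g, ?_⟩
  refine mk_mem_nonZeroDivisors_of_inf_eq _ (Ideal.span {(X 0 : MvPolynomial (Fin 3) A)}) (Ideal.span {X 1})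
    (Summit.ResolutionOfSingularities.ResolutionOfSingularities.Theorems.EquisingularLift.Junction.span_X0_inf_span_X1)
    ?_ ?_
  · rwa [Ideal.mem_span_singleton]
  · rwa [Ideal.mem_span_singleton]

end Model

end Summit.ResolutionOfSingularities.ResolutionOfSingularities.Cruxes.EquisingularLiftNat.Sections.SheetTangent
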